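import Literature.NumberTheory.Transcendental.FormsAlgebra
import Literature.Geometry.Kaehler.HodgeStarBasisProofs
import Literature.Geometry.Kaehler.RiemannianHodge
import HarnessLib

/-!
# The Hodge star and the wedge product: `β ∧ ⋆γ = ⟨β, γ⟩ vol`

Topic: Kähler / Hodge, the pointwise Hodge star of `Literature/Geometry/Kaehler/HodgeStar.lean`
(`Literature.Geometry.Kaehler.hodgeStar`, defined by the basis formula
`(⋆γ)(w) = ∑ₛ γ(b_s) vol(b_s, w)`) against the wedge product of continuous alternating maps of
`Literature/NumberTheory/Transcendental/FormsAlgebra.lean` (`ContinuousAlternatingMap.wedge`,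
shuffle normalisation `(α ∧ β)(v) = (k! l!)⁻¹ ∑_σ sign σ · α(v ∘ σ|₁) β(v ∘ σ|₂)`,
Warner (1983), 2.10(b)). `HodgeStar.lean` could not state the defining property of `⋆`,
"`β ∧ ⋆γ = ⟨β, γ⟩ vol`" (Warner (1983), Ch. 2, Exercise 13 (2), eq. (2), p. 79, and 6.1 (5),
p. 220: `⟨α, β⟩ = ∫_M α ∧ ⋆β`), for want of a wedge product, and replaced it by the contraction
formula `hodgeStar_apply_eq_alternatingFormInner`. This file proves the genuine identity, for
all degrees `k + m = n`:

* `Literature.Geometry.Kaehler.wedge_hodgeStar`: on an oriented `n`-dimensional real inner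
  product space, `(β ∧ ⋆γ) = ⟨β, γ⟩ • vol` for `k`-forms `β`, `γ` (the `(k + m)`-form on the
  left reindexed to an `n`-form along `finCongr h`);
* `Literature.Geometry.Kaehler.MForm.wedge_hodgeStar`: the same pointwise on a Riemannian manifold
  with orientation family `o`: `(β ∧ ⋆γ).castDeg h = ⟨β, γ⟩ • vol_o`
  (`MForm.wedge`, `MForm.hodgeStar`, `MForm.inner`, `riemannianVolumeForm`).

These are the pointwise input of Warner's Prop. 6.2 (`δ` is the adjoint of `d`,
`∫ dα ∧ ⋆β = ∫ α ∧ ⋆δβ`) and Prop. 6.3 (`Δα = 0 ↔ dα = 0 ∧ δα = 0`).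

## Proof

Both sides are top-degree forms, so it suffices to evaluate them on the orthonormal basis
`b = stdOrthonormalBasisFin V n` used in the definition of `⋆` (`ext_of_apply_basis`). In the
shuffle sum `∑_σ sign σ · β(b ∘ σ|₁) · (⋆γ)(b ∘ σ|₂)` reindex the permutations `σ` of
`Fin (k + m)` by triples `(s, τ, τ')` — a `k`-subset `s`, a permutation `τ` of `Fin k` and a
permutation `τ'` of `Fin m` — through the block permutation `[e_s ∘ τ | e_{sᶜ} ∘ τ']`
(`blockPerm`; a bijection by injectivity and the count `C(k+m, k) k! m! = (k + m)!`). For the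
permutation attached to `(s, τ, τ')`: `β(b_s ∘ τ) = sign τ · β(b_s)`; in
`(⋆γ)(b_{sᶜ} ∘ τ') = ∑_{s'} γ(b_{s'}) vol(b_{s'}, b_{sᶜ} ∘ τ')` only `s' = s` survives (a repeated
basis vector otherwise); and `vol(b_s, b_{sᶜ} ∘ τ') = sign τ · sign σ · vol(b)` (the contracted
volume form is alternating in its first block, `interiorProductMulti_volumeFormL_swap`). The signs
cancel in pairs, each triple contributes `β(b_s) γ(b_s) vol(b)`, and the `k! m!` triples over a
fixed `s` cancel the normalisation: `(β ∧ ⋆γ)(b) = ∑ₛ β(b_s) γ(b_s) · vol(b) = ⟨β, γ⟩ vol(b)`.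
This is Warner's computation of Exercise 2.13 (2) (`e_I ∧ ⋆e_I = vol`, `e_I ∧ ⋆e_J = 0` for
`I ≠ J`) run on Mathlib's model.

## References

* F. W. Warner, *Foundations of Differentiable Manifolds and Lie Groups*, GTM 94, Springer
  (1983), Ch. 2, 2.10(b) (the wedge product), Exercise 13 (2), p. 79 (`⋆` and
  `⟨·, ·⟩` on `Λ(V)`), and 6.1 (5), p. 220 (`⟨α, β⟩ = ∫_M α ∧ ⋆β`).
-/

noncomputable section

open Module ContinuousAlternatingMap Function Set.powersetCard
open scoped Manifold

namespace Literature.Geometry.Kaehler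

namespace HodgeStarAux

/-! ### Block permutations `[e_s ∘ τ | e_{sᶜ} ∘ τ']` of `Fin (k + m)` -/

section BlockPerm

variable {k m : ℕ}

/-- `m + k` is the cardinality of `Fin (k + m)` (the shape of the hypothesis of
`Set.powersetCard.compl`). [folklore] -/
theorem card_fin_add : m + k = Fintype.card (Fin (k + m)) := by
  rw [Fintype.card_fin, Nat.add_comm]

/-- Composition distributes over `Fin.append`: `[g ∘ u | g ∘ u'] = g ∘ [u | u']`. [folklore] -/
theorem append_comp_eq {X Y : Type*} (g : X → Y) (u : Fin k → X) (u' : Fin m → X) :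
    Fin.append (g ∘ u) (g ∘ u') = g ∘ Fin.append u u' := by
  funext z
  cases z using Fin.addCases <;> simp

/-- The map `[e_s ∘ τ | e_{sᶜ} ∘ τ'] : Fin (k + m) → Fin (k + m)` attached to a `k`-subset `s` of
`Fin (k + m)` and permutations `τ`, `τ'` of the two blocks (`e_s` the increasing enumeration of
`s`, `e_{sᶜ}` that of its complement) is injective. [folklore] -/
theorem blockMap_injective (s : Set.powersetCard (Fin (k + m)) k) (τ : Equiv.Perm (Fin k))
    (τ' : Equiv.Perm (Fin m)) :
    Injective (Fin.append (⇑(ofFinEmbEquiv.symm s) ∘ ⇑τ)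
      (⇑(ofFinEmbEquiv.symm (Set.powersetCard.compl card_fin_add s)) ∘ ⇑τ')) := by
  refine Fin.append_injective_iff.2 ⟨(ofFinEmbEquiv.symm s).injective.comp τ.injective,
    (ofFinEmbEquiv.symm _).injective.comp τ'.injective, fun i j hij ↦ ?_⟩
  have h1 : ofFinEmbEquiv.symm s (τ i) ∈ s := enum_mem s _
  have h2 : ofFinEmbEquiv.symm (Set.powersetCard.compl card_fin_add s) (τ' j) ∈
      Set.powersetCard.compl card_fin_add s := enum_mem _ _
  rw [Set.powersetCard.mem_compl] at h2
  rw [comp_apply, comp_apply] at hij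
  rw [← hij] at h2
  exact h2 h1

/-- The map `[e_s ∘ τ | e_{sᶜ} ∘ τ']` is a bijection of `Fin (k + m)`; the corresponding
permutation `Equiv.ofBijective _ (blockMap_bijective s τ τ')` is the **block permutation**
attached to the triple `(s, τ, τ')` (written out in full below: a proof device of this file, not
a definition of the library). [folklore] -/
theorem blockMap_bijective (s : Set.powersetCard (Fin (k + m)) k) (τ : Equiv.Perm (Fin k))
    (τ' : Equiv.Perm (Fin m)) :
    Bijective (Fin.append (⇑(ofFinEmbEquiv.symm s) ∘ ⇑τ)
      (⇑(ofFinEmbEquiv.symm (Set.powersetCard.compl card_fin_add s)) ∘ ⇑τ')) :=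
  (blockMap_injective s τ τ').bijective_of_finite

/-- First block of `blockPerm`. [folklore] -/
@[simp]
theorem blockPerm_apply_castAdd (s : Set.powersetCard (Fin (k + m)) k) (τ : Equiv.Perm (Fin k))
    (τ' : Equiv.Perm (Fin m)) (i : Fin k) :
    Equiv.ofBijective _ (blockMap_bijective s τ τ') (Fin.castAdd m i) =
      ofFinEmbEquiv.symm s (τ i) := by
  rw [Equiv.coe_ofBijective, Fin.append_left, comp_apply]

/-- Second block of `blockPerm`. [folklore] -/
@[simp]
theorem blockPerm_apply_natAdd (s : Set.powersetCard (Fin (k + m)) k) (τ : Equiv.Perm (Fin k))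
    (τ' : Equiv.Perm (Fin m)) (j : Fin m) :
    Equiv.ofBijective _ (blockMap_bijective s τ τ') (Fin.natAdd k j) =
      ofFinEmbEquiv.symm (Set.powersetCard.compl card_fin_add s) (τ' j) := by
  rw [Equiv.coe_ofBijective, Fin.append_right, comp_apply]

/-- Two `k`-subsets with the same enumeration ranges (up to permutations of `Fin k`) are equal.
[folklore] -/
theorem eq_of_enum_comp_eq {s s' : Set.powersetCard (Fin (k + m)) k} {τ τ₂ : Equiv.Perm (Fin k)}
    (h : ⇑(ofFinEmbEquiv.symm s) ∘ ⇑τ = ⇑(ofFinEmbEquiv.symm s') ∘ ⇑τ₂) : s = s' := by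
  refine SetLike.ext fun a ↦ ?_
  rw [← mem_range_ofFinEmbEquiv_symm_iff_mem, ← mem_range_ofFinEmbEquiv_symm_iff_mem,
    ← EquivLike.range_comp _ τ, ← EquivLike.range_comp (ofFinEmbEquiv.symm s') τ₂, h]

/-- **The triples `(s, τ, τ')` parametrise the permutations of `Fin (k + m)` injectively.**
[folklore] -/
theorem blockPerm_injective :
    Injective fun p : Set.powersetCard (Fin (k + m)) k × Equiv.Perm (Fin k) × Equiv.Perm (Fin m) ↦
      Equiv.ofBijective _ (blockMap_bijective p.1 p.2.1 p.2.2) := by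
  rintro ⟨s, τ, τ'⟩ ⟨s₂, τ₂, τ₂'⟩ hp
  have hp' : ⇑(Equiv.ofBijective _ (blockMap_bijective s τ τ')) =
      ⇑(Equiv.ofBijective _ (blockMap_bijective s₂ τ₂ τ₂')) := by
    simp only at hp
    rw [hp]
  have h1 : ⇑(ofFinEmbEquiv.symm s) ∘ ⇑τ = ⇑(ofFinEmbEquiv.symm s₂) ∘ ⇑τ₂ := by
    funext i
    have := congrFun hp' (Fin.castAdd m i)
    simpa only [blockPerm_apply_castAdd, comp_apply] using this
  obtain rfl : s = s₂ := eq_of_enum_comp_eq h1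
  have hτ : τ = τ₂ := Equiv.ext fun i ↦ (ofFinEmbEquiv.symm s).injective (congrFun h1 i)
  have hτ' : τ' = τ₂' := Equiv.ext fun j ↦ (ofFinEmbEquiv.symm _).injective (by
    have := congrFun hp' (Fin.natAdd k j)
    simpa only [blockPerm_apply_natAdd] using this)
  rw [hτ, hτ']

/-- The count `C(k + m, k) · k! · m! = (k + m)!`: the triples `(s, τ, τ')` are as many as the
permutations of `Fin (k + m)`. [folklore] -/
theorem card_triples :
    Fintype.card (Set.powersetCard (Fin (k + m)) k × Equiv.Perm (Fin k) × Equiv.Perm (Fin m)) =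
      Fintype.card (Equiv.Perm (Fin (k + m))) := by
  have hc : Fintype.card (Set.powersetCard (Fin (k + m)) k) = (k + m).choose k := by
    rw [← Nat.card_eq_fintype_card, Set.powersetCard.card, Nat.card_eq_fintype_card,
      Fintype.card_fin]
  rw [Fintype.card_prod, Fintype.card_prod, Fintype.card_perm, Fintype.card_perm,
    Fintype.card_perm, Fintype.card_fin, Fintype.card_fin, Fintype.card_fin, hc, ← mul_assoc]
  have := Nat.add_choose_mul_factorial_mul_factorial k m
  rwa [← Nat.choose_symm_add] at this

/-- **The triples `(s, τ, τ')` parametrise the permutations of `Fin (k + m)` bijectively.**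
[folklore] -/
theorem blockPerm_bijective :
    Bijective fun p : Set.powersetCard (Fin (k + m)) k × Equiv.Perm (Fin k) × Equiv.Perm (Fin m) ↦
      Equiv.ofBijective _ (blockMap_bijective p.1 p.2.1 p.2.2) :=
  (Fintype.bijective_iff_injective_and_card _).2 ⟨blockPerm_injective, card_triples⟩

/-- Reindexing a sum over the permutations of `Fin (k + m)` by the triples `(s, τ, τ')`; when the
summand only depends on the `k`-subset `s` of the first block, each `s` is counted `k! m!` times.
[folklore] -/
theorem sum_perm_eq_sum_triples {R : Type*} [AddCommMonoid R]
    (T : Equiv.Perm (Fin (k + m)) → R) (F : Set.powersetCard (Fin (k + m)) k → R)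
    (hTF : ∀ s τ τ', T (Equiv.ofBijective _ (blockMap_bijective s τ τ')) = F s) :
    ∑ σ, T σ = (k.factorial * m.factorial) • ∑ s, F s := by
  rw [← Fintype.sum_bijective _ blockPerm_bijective (fun p ↦ F p.1) T
    (fun p ↦ (hTF p.1 p.2.1 p.2.2).symm)]
  rw [Fintype.sum_prod_type, Finset.smul_sum]
  refine Finset.sum_congr rfl fun s _ ↦ ?_
  simp only [Finset.sum_const, Finset.card_univ, Fintype.card_prod, Fintype.card_perm,
    Fintype.card_fin]

end BlockPerm

/-! ### The contracted volume form on basis blocks -/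

section Volume

variable {V : Type*} [NormedAddCommGroup V] [InnerProductSpace ℝ V] {k m : ℕ}
  [Fact (finrank ℝ V = k + m)] (o : Orientation ℝ V (Fin (k + m)))

/-- The contracted volume form of `hodgeStar` (first block `v`, second block `w`) is the volume
form on `[v | w]` (the two reindexings along `k + m = m + k` cancel). [folklore] -/
theorem interiorProductMulti_volumeFormL_eq (v : Fin k → V) (w : Fin m → V) :
    (o.volumeFormL.domDomCongr (finCongr (show k + m = m + k by omega))).interiorProductMulti k v w =
      o.volumeForm (Fin.append v w) := by
  rw [interiorProductMulti_apply, domDomCongr_apply, Orientation.volumeFormL_apply]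
  congr 1

/-- The contracted volume form vanishes when the two blocks share a vector. [folklore] -/
theorem interiorProductMulti_volumeFormL_eq_zero {v : Fin k → V} {w : Fin m → V} {i : Fin k}
    {j : Fin m} (h : v i = w j) :
    (o.volumeFormL.domDomCongr (finCongr (show k + m = m + k by omega))).interiorProductMulti k v w =
      0 := by
  rw [interiorProductMulti_volumeFormL_eq]
  refine AlternatingMap.map_eq_zero_of_eq _ _ (i := Fin.castAdd m i) (j := Fin.natAdd k j) ?_ ?_
  · rw [Fin.append_left, Fin.append_right, h]
  · intro heq
    have := congrArg Fin.val heq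
    simp only [Fin.val_castAdd, Fin.val_natAdd] at this
    omega

/-- The contracted volume form is alternating in its first block:
`vol(v ∘ π, w) = sign π · vol(v, w)` (swap the blocks, `interiorProductMulti_volumeFormL_swap`, to
see the first block as the argument of the continuous alternating `k`-form `ι_w vol`).
[folklore] -/
theorem interiorProductMulti_volumeFormL_comp_perm (v : Fin k → V) (w : Fin m → V)
    (π : Equiv.Perm (Fin k)) :
    (o.volumeFormL.domDomCongr (finCongr (show k + m = m + k by omega))).interiorProductMulti k
        (v ∘ π) w =
      ((Equiv.Perm.sign π : ℤ) : ℝ) *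
        (o.volumeFormL.domDomCongr (finCongr (show k + m = m + k by omega))).interiorProductMulti
          k v w := by
  rw [interiorProductMulti_volumeFormL_swap o rfl (v ∘ π) w,
    interiorProductMulti_volumeFormL_swap o rfl v w, ← coe_toAlternatingMap,
    AlternatingMap.map_perm, coe_toAlternatingMap, Units.smul_def, zsmul_eq_mul]
  ring

end Volume

/-! ### The shuffle summands of `β ∧ ⋆γ` on the standard basis -/

section Summand

variable {V : Type*} [NormedAddCommGroup V] [InnerProductSpace ℝ V] [FiniteDimensional ℝ V]
  {k m : ℕ} [Fact (finrank ℝ V = k + m)] (o : Orientation ℝ V (Fin (k + m)))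

/-- The Hodge star of `γ` on a basis block `b ∘ u'` (`b = stdOrthonormalBasisFin`):
`(⋆γ)(b ∘ u') = ∑ₛ γ(b_s) vol(b_s, b ∘ u')`, with the contracted volume form of `hodgeStar`.
[folklore] -/
theorem hodgeStar_apply_basis_comp (γ : V [⋀^Fin k]→L[ℝ] ℝ) (u' : Fin m → Fin (k + m)) :
    hodgeStar o rfl γ (stdOrthonormalBasisFin V (k + m) ∘ u') =
      ∑ s : Set.powersetCard (Fin (k + m)) k, γ ((stdOrthonormalBasisFin V (k + m)).multiIndex s) *
        (o.volumeFormL.domDomCongr (finCongr (show k + m = m + k by omega))).interiorProductMulti k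
          ((stdOrthonormalBasisFin V (k + m)).multiIndex s) (stdOrthonormalBasisFin V (k + m) ∘ u') :=
  hodgeStar_apply o rfl γ _

/-- A square of the sign of a permutation, cast to `ℝ`, is `1`. [folklore] -/
theorem sign_mul_sign_cast (σ : Equiv.Perm (Fin k)) :
    ((Equiv.Perm.sign σ : ℤ) : ℝ) * ((Equiv.Perm.sign σ : ℤ) : ℝ) = 1 := by
  rw [← Int.cast_mul, ← Units.val_mul, Int.units_mul_self, Units.val_one, Int.cast_one]

/-- **The shuffle summand attached to the triple `(s, τ, τ')`.** With `b = stdOrthonormalBasisFin`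
and `σ = Equiv.ofBijective _ (blockMap_bijective s τ τ')`,
`sign σ · β(b ∘ σ|₁) · (⋆γ)(b ∘ σ|₂) = β(b_s) γ(b_s) vol(b)`: only the summand `s` of `⋆γ`
survives on the block `b_{sᶜ} ∘ τ'`, and the four signs `sign σ, sign τ, sign τ, sign σ` cancel.
Warner (1983), Ch. 2, Ex. 13 (2): `e_I ∧ ⋆e_I = vol`. [cite: WarnerGTM94, Ch. 2 Ex. 13 (2), p. 79] -/
theorem wedge_hodgeStar_summand (β γ : V [⋀^Fin k]→L[ℝ] ℝ) (s : Set.powersetCard (Fin (k + m)) k)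
    (τ : Equiv.Perm (Fin k)) (τ' : Equiv.Perm (Fin m)) :
    Equiv.Perm.sign (Equiv.ofBijective _ (blockMap_bijective s τ τ')) •
        (β (fun i ↦ stdOrthonormalBasisFin V (k + m)
            (Equiv.ofBijective _ (blockMap_bijective s τ τ') (Fin.castAdd m i))) *
          hodgeStar o rfl γ (fun j ↦ stdOrthonormalBasisFin V (k + m)
            (Equiv.ofBijective _ (blockMap_bijective s τ τ') (Fin.natAdd k j)))) =
      β ((stdOrthonormalBasisFin V (k + m)).multiIndex s) *
        γ ((stdOrthonormalBasisFin V (k + m)).multiIndex s) *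
          o.volumeForm (stdOrthonormalBasisFin V (k + m)) := by
  set b := stdOrthonormalBasisFin V (k + m) with hb
  set σ := Equiv.ofBijective _ (blockMap_bijective s τ τ') with hσ
  set t := Set.powersetCard.compl card_fin_add s with ht
  set u' : Fin m → Fin (k + m) := ⇑(ofFinEmbEquiv.symm t) ∘ ⇑τ' with hu'
  have hts : ∀ a, a ∈ t ↔ a ∉ s := fun a ↦ Set.powersetCard.mem_compl
  -- the two blocks of `b ∘ σ`
  have h1 : (fun i ↦ b (σ (Fin.castAdd m i))) = b.multiIndex s ∘ ⇑τ := by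
    funext i
    rw [hσ, blockPerm_apply_castAdd, comp_apply, OrthonormalBasis.multiIndex_apply]
  have h2 : (fun j ↦ b (σ (Fin.natAdd k j))) = ⇑b ∘ u' := by
    funext j
    rw [hσ, blockPerm_apply_natAdd, comp_apply, hu', comp_apply]
  -- `β(b_s ∘ τ) = sign τ · β(b_s)`
  have hβ : β (b.multiIndex s ∘ ⇑τ) = ((Equiv.Perm.sign τ : ℤ) : ℝ) * β (b.multiIndex s) := by
    rw [← coe_toAlternatingMap, AlternatingMap.map_perm, coe_toAlternatingMap, Units.smul_def,
      zsmul_eq_mul]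
  -- `(⋆γ)(b ∘ u') = γ(b_s) vol(b_s, b ∘ u')`: the other summands have a repeated vector
  have hstar : hodgeStar o rfl γ (⇑b ∘ u') = γ (b.multiIndex s) *
      (o.volumeFormL.domDomCongr (finCongr (show k + m = m + k by omega))).interiorProductMulti k
        (b.multiIndex s) (⇑b ∘ u') := by
    rw [hb, hodgeStar_apply_basis_comp, ← hb]
    refine Fintype.sum_eq_single s fun s' hs' ↦ ?_
    obtain ⟨a, has', has⟩ := (Set.powersetCard.exists_mem_notMem_iff_ne s' s).1 hs'
    obtain ⟨i, hi⟩ := exists_enum_eq_of_mem has'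
    obtain ⟨j₀, hj₀⟩ := exists_enum_eq_of_mem ((hts a).2 has)
    rw [interiorProductMulti_volumeFormL_eq_zero o (i := i) (j := τ'.symm j₀) ?_, mul_zero]
    simp only [OrthonormalBasis.multiIndex_apply, comp_apply, hu', Equiv.apply_symm_apply, hi, hj₀]
  -- `vol(b_s ∘ τ, b ∘ u') = vol(b ∘ σ) = sign σ · vol(b)`
  have hvolσ : (o.volumeFormL.domDomCongr (finCongr (show k + m = m + k by omega))).interiorProductMulti
      k (b.multiIndex s ∘ ⇑τ) (⇑b ∘ u') = ((Equiv.Perm.sign σ : ℤ) : ℝ) * o.volumeForm b := by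
    have hbs : (b.multiIndex s ∘ ⇑τ : Fin k → V) = ⇑b ∘ (⇑(ofFinEmbEquiv.symm s) ∘ ⇑τ) := by
      funext i
      simp only [comp_apply, OrthonormalBasis.multiIndex_apply]
    rw [interiorProductMulti_volumeFormL_eq, hbs, append_comp_eq,
      ← Equiv.coe_ofBijective _ (blockMap_bijective s τ τ'), ← hσ, AlternatingMap.map_perm,
      Units.smul_def, zsmul_eq_mul]
  -- hence `vol(b_s, b ∘ u') = sign τ · sign σ · vol(b)`
  have hvol : (o.volumeFormL.domDomCongr (finCongr (show k + m = m + k by omega))).interiorProductMulti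
      k (b.multiIndex s) (⇑b ∘ u') =
        ((Equiv.Perm.sign τ : ℤ) : ℝ) * (((Equiv.Perm.sign σ : ℤ) : ℝ) * o.volumeForm b) := by
    have h := interiorProductMulti_volumeFormL_comp_perm o (b.multiIndex s) (⇑b ∘ u') τ
    rw [hvolσ] at h
    have hsq := sign_mul_sign_cast τ
    calc (o.volumeFormL.domDomCongr (finCongr (show k + m = m + k by omega))).interiorProductMulti
          k (b.multiIndex s) (⇑b ∘ u')
        = (((Equiv.Perm.sign τ : ℤ) : ℝ) * ((Equiv.Perm.sign τ : ℤ) : ℝ)) *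
            (o.volumeFormL.domDomCongr (finCongr (show k + m = m + k by omega))).interiorProductMulti
              k (b.multiIndex s) (⇑b ∘ u') := by rw [hsq, one_mul]
      _ = ((Equiv.Perm.sign τ : ℤ) : ℝ) * (((Equiv.Perm.sign σ : ℤ) : ℝ) * o.volumeForm b) := by
          rw [mul_assoc, ← h]
  rw [h1, h2, hβ, hstar, hvol, Units.smul_def, zsmul_eq_mul]
  have hσsq := sign_mul_sign_cast σ
  have hτsq := sign_mul_sign_cast τ
  linear_combination (β (b.multiIndex s) * γ (b.multiIndex s) * o.volumeForm b) *
    (((Equiv.Perm.sign τ : ℤ) : ℝ) * ((Equiv.Perm.sign τ : ℤ) : ℝ) * hσsq + hτsq)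

end Summand

/-! ### Top forms are determined by one basis tuple -/

section Ext

variable {V : Type*} [NormedAddCommGroup V] [NormedSpace ℝ V] {n : ℕ}

/-- Two continuous alternating top-degree forms agreeing on one basis agree
(`AlternatingMap.eq_smul_basis_det`). [folklore] -/
theorem ext_of_apply_basis (b : Basis (Fin n) ℝ V) {f g : V [⋀^Fin n]→L[ℝ] ℝ} (h : f b = g b) :
    f = g := by
  apply toAlternatingMap_injective
  rw [AlternatingMap.eq_smul_basis_det b f.toAlternatingMap,
    AlternatingMap.eq_smul_basis_det b g.toAlternatingMap, coe_toAlternatingMap,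
    coe_toAlternatingMap, h]

end Ext

end HodgeStarAux

/-! ### `β ∧ ⋆γ = ⟨β, γ⟩ vol` -/

section WedgeStar

open HodgeStarAux

variable {V : Type*} [NormedAddCommGroup V] [InnerProductSpace ℝ V] [FiniteDimensional ℝ V]
  {n : ℕ} [Fact (finrank ℝ V = n)] (o : Orientation ℝ V (Fin n)) {k m : ℕ}

/-- **The Hodge star is characterised by the wedge product**: on an oriented `n`-dimensional real
inner product space, for continuous alternating `k`-forms `β`, `γ` and `k + m = n`,
`β ∧ ⋆γ = ⟨β, γ⟩ vol` — the `(k + m)`-form `β.wedge (hodgeStar o h γ)` (shuffle-normalised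
wedge of `FormsAlgebra.lean`) reindexed along `finCongr h : Fin (k + m) ≃ Fin n` is
`alternatingFormInner V n k β γ • o.volumeFormL`. Warner, *Foundations of Differentiable
Manifolds and Lie Groups*, Ch. 2, Exercise 13 (2), p. 79: with `⟨·, ·⟩` the inner product on
`Λ(V)` for which the `e_I` are orthonormal and `*e_I = ± e_{Iᶜ}`, "`α ∧ *β = ⟨α, β⟩ e₁ ∧ ⋯ ∧ eₙ`";
recalled in 6.1, p. 220. [cite: WarnerGTM94, Ch. 2 Ex. 13 (2), p. 79] -/
theorem wedge_hodgeStar (h : k + m = n) (β γ : V [⋀^Fin k]→L[ℝ] ℝ) :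
    (β.wedge (hodgeStar o h γ)).domDomCongr (finCongr h) =
      alternatingFormInner V n k β γ • o.volumeFormL := by
  subst h
  rw [show finCongr (rfl : k + m = k + m) = Equiv.refl _ from Equiv.ext fun i ↦ Fin.ext rfl,
    domDomCongr_refl]
  set b := stdOrthonormalBasisFin V (k + m) with hb
  refine ext_of_apply_basis b.toBasis ?_
  rw [OrthonormalBasis.coe_toBasis, ContinuousAlternatingMap.smul_apply,
    Orientation.volumeFormL_apply, smul_eq_mul, alternatingFormInner_apply, ← hb,
    ContinuousAlternatingMap.wedge_apply]
  rw [sum_perm_eq_sum_triples _ (fun s ↦ β (b.multiIndex s) * γ (b.multiIndex s) * o.volumeForm b)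
    (fun s τ τ' ↦ by rw [hb]; exact wedge_hodgeStar_summand o β γ s τ τ')]
  rw [← Finset.sum_mul, nsmul_eq_mul, smul_eq_mul, ← mul_assoc, Nat.cast_mul,
    inv_mul_cancel₀ (by positivity), one_mul]

/-- Diagonal case: `β ∧ ⋆β = ‖β‖² vol` with `0 ≤ ‖β‖² = ⟨β, β⟩`
(Warner (1983), Ch. 2, Ex. 13 (2) and 6.1 (5): the form `⟨α, β⟩ = ∫ α ∧ ⋆β` is positive
definite). [cite: WarnerGTM94, Ch. 2 Ex. 13 (2), p. 79] -/
theorem wedge_hodgeStar_self (h : k + m = n) (β : V [⋀^Fin k]→L[ℝ] ℝ) :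
    (β.wedge (hodgeStar o h β)).domDomCongr (finCongr h) =
      alternatingFormInner V n k β β • o.volumeFormL :=
  wedge_hodgeStar o h β β

end WedgeStar

/-! ### On a Riemannian manifold -/

section Manifold

open Bundle

variable {E : Type*} [NormedAddCommGroup E] [NormedSpace ℝ E] {n : ℕ} [Fact (finrank ℝ E = n)]
  {H : Type*} [TopologicalSpace H] {I : ModelWithCorners ℝ E H}
  {M : Type*} [TopologicalSpace M] [ChartedSpace H M] [FiniteDimensional ℝ E]
  [RiemannianBundle (fun x : M ↦ TangentSpace I x)] {k m : ℕ}
  (o : (x : M) → Orientation ℝ (TangentSpace I x) (Fin n))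

/-- **`β ∧ ⋆γ = ⟨β, γ⟩ vol` on a Riemannian manifold** (pointwise, no smoothness involved): for
`k`-forms `β`, `γ` on a Riemannian `n`-manifold with orientation family `o` and `k + m = n`,
the wedge `β ∧ ⋆γ` (`MForm.wedge`, `MForm.hodgeStar`), cast from degree `k + m` to degree `n`
(`MForm.castDeg h`), is the pointwise inner product `MForm.inner n β γ` times the Riemannian volume
form `riemannianVolumeForm o`. Warner (1983), 6.1 (5), p. 220 (`⟨α, β⟩ = ∫_M α ∧ *β` with
`α ∧ *β = ⟨α, β⟩ vol` pointwise, Ch. 2, Ex. 13 (2)). [cite: WarnerGTM94, 6.1 (5), p. 220] -/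
theorem MForm.wedge_hodgeStar (h : k + m = n) (β γ : MForm I M ℝ k) :
    (β.wedge (MForm.hodgeStar o h γ)).castDeg h = fun x ↦
      MForm.inner n β γ x • riemannianVolumeForm o x := by
  funext x
  exact Literature.Geometry.Kaehler.wedge_hodgeStar (o x) h (β x) (γ x)

end Manifold

end Literature.Geometry.Kaehler
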